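import Literature.Computability.Complexity.Hastad3SatEstimates
import Mathlib.Analysis.SpecialFunctions.Pow.Real
import HarnessLib

/-!
# Håstad's 3-SAT test `3S^ε`: soundness at one `W`-vertex under smooth projections (Lemmas 6.7, 6.11, 6.13)

Håstad, *Some optimal inapproximability results*, J. ACM 48 (2001), §6.1.  The soundness analysis of
Test `3S^ε` at one vertex of the projected side: a folded table `B` on `{0,1}^κ`, and a probability
distribution `w` on finitely many "`U`-choices" `j`, each with a projection `π j : κ → ι` and a
folded table `A j` on `{0,1}^ι` (in Håstad's verifier: the random set `U` of one variable per
clause of `W`; in a label cover instance: the edges at a vertex).  By eq. (34)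
(`accProb_eq`, `Hastad3SatTest.lean`) the acceptance probability averaged over `j` is
`7/8 - (E_j[termOne_j] + E_j[termTwo_j])/8`, and the two expectations are controlled as follows.

* **Smoothness hypothesis** (in place of Håstad's Lemma 6.9 / Cor. 6.10 about a random `U`): for
  every set `β'` of at most `T` labels there is a set `G` of choices `j` on which `π j` is injective
  on `β'`, of total weight `≥ 1 - ξ`.  Håstad's own verifier only has the weaker property of
  Lemma 6.9 (`E_U[1/S^U(β)] ≤ (ε|β|)^{-c}`, proved by a martingale argument in his appendix) and
  compensates with the mixture `F3S^δ` of tests `3S^{ε_i}`; for projections that are injective on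
  small sets with high probability — the *smooth* projections of Khot (FOCS 2002, obtained by
  revealing most coordinates of a parallel repetition) — one value of `ε` suffices, because on an
  injective `π` every fibre has `s_x = 1` and `p(∅, β) = (-ε)^{|β|}` (`termProd_empty_of_injOn`).
* **Lemma 6.7 (smooth form)**, `abs_avg_termOne_le`:
  `|E_j termOne_j| ≤ ε + exp(-Tε/4) + ξ` — sets `|β| ≤ T` contribute `≤ ε^{|β|} ≤ ε` on the
  injective choices, sets `|β| > T` contain a `β'` of size `T` on which injectivity gives
  `S^U(β) ≥ S^U(β') = Tε` and eq. (40) gives `|p| ≤ exp(-Tε/4)`; the non-injective choices weigh `≤ ξ`.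
* **Lemma 6.11 (smooth form)**: `termTwo_j = S_j + L_j` (sets of size `≤ T` / `> T`);
  `|E_j L_j| ≤ exp(-Tε/8) + ξ` by Cauchy–Schwarz in `α` and eq. (44) (`abs_avg_large_le`), and
  `|E_j S_j| ≤ √(T · Q)` (`abs_avg_small_le_sqrt`) where
  `Q = E_j ∑_β ∑_{α ⊆ π_j(β)} b̂(β)² â_j(α)² / |β|` (`decodeQ`) is Håstad's lower bound (43) for the
  success probability of the decoded prover strategies ("`P₁` chooses `β` with probability `B̂_β²`
  and a random `y ∈ β`, `P₂` chooses `α` with probability `Â_α²` and a random `x ∈ α`"), by the two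
  Cauchy–Schwarz steps of p. 48.
* **The vertex soundness inequality** (`smooth_vertex_soundness`, the quantitative content of
  Lemma 6.13 for one value of `ε`):
  `8 (E_j[accProb_j] - 7/8) ≤ ε + e^{-Tε/4} + e^{-Tε/8} + 2ξ + √(T · Q)`.
  So if the test accepts with probability `≥ 7/8 + δ` at this vertex and the parameters make the
  first four terms `≤ 4δ`, then `Q ≥ 16 δ² / T`.

Everything is proved; the conversion of `Q` into strategies of the two-prover game and the averaging
over the vertices of the projected side are done where the game is (later files).

## References

* J. Håstad, *Some optimal inapproximability results*, J. ACM 48 (2001) 798–859, §6.1: Lemmas 6.7,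
  6.11, 6.13, eqs. (40)–(45) [Hastad2001].
* S. Khot, *Hardness results for coloring 3-colorable 3-uniform hypergraphs*, FOCS 2002, §3 (smooth
  label cover) — the source of the smoothness hypothesis used here in place of Lemma 6.9.
-/

noncomputable section

namespace Literature.Computability.Complexity.Hastad3Sat

open Finset Literature.Probability.RandomGraphs.LowDegree Literature.Computability.Complexity.LongCode

variable {ι κ J : Type*}

/-! ### Smooth families of projections and the decoding quantity `Q` -/

/-- A weighted family of projections `π j : κ → ι` is **`(T, ξ)`-smooth** if every set of at most `T`
labels is mapped injectively by all choices `j` outside a set of weight at most `ξ`.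
[cite: Hastad2001, §6.1 (role of Lemma 6.9 / Cor. 6.10)] -/
def Smooth [Fintype J] [DecidableEq J] (w : J → ℝ) (π : J → κ → ι) (T : ℕ) (ξ : ℝ) : Prop :=
  ∀ β' : Finset κ, β'.card ≤ T →
    ∃ G : Finset J, (∀ j ∈ G, Set.InjOn (π j) ↑β') ∧ ∑ j ∈ Gᶜ, w j ≤ ξ

/-- Håstad's lower bound (43) for the success of the decoded strategies at one `W`-vertex:
`Q = ∑_j w_j ∑_β ∑_{α ⊆ π_j(β)} b̂(β)² â_j(α)² / |β|`. [cite: Hastad2001, eq. (43)] -/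
def decodeQ [Fintype ι] [DecidableEq ι] [Fintype κ] [DecidableEq κ] [Fintype J] (w : J → ℝ)
    (π : J → κ → ι) (A : J → (ι → Bool) → Bool) (B : (κ → Bool) → Bool) : ℝ :=
  ∑ j, w j * ∑ β : Finset κ, ∑ α ∈ (β.image (π j)).powerset,
    coeff (fun g => sgn (B g)) β ^ 2 * coeff (fun f => sgn (A j f)) α ^ 2 / β.card

/-- `Q ≥ 0`. [cite: Hastad2001, eq. (43)] -/
theorem decodeQ_nonneg [Fintype ι] [DecidableEq ι] [Fintype κ] [DecidableEq κ] [Fintype J]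
    {w : J → ℝ} (hw : ∀ j, 0 ≤ w j) (π : J → κ → ι)
    (A : J → (ι → Bool) → Bool) (B : (κ → Bool) → Bool) : 0 ≤ decodeQ w π A B :=
  sum_nonneg fun j _ => mul_nonneg (hw j) (sum_nonneg fun β _ => sum_nonneg fun α _ => by positivity)

/-! ### Weights -/

/-- The weight of a set of choices is at most `1`. [folklore] -/
theorem sum_weight_le_one [Fintype J] {w : J → ℝ} (hw : ∀ j, 0 ≤ w j) (hw1 : ∑ j, w j = 1) (G : Finset J) :
    ∑ j ∈ G, w j ≤ 1 :=
  (sum_le_univ_sum_of_nonneg hw).trans hw1.le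

/-- Averaging a function bounded by `M` on `G` and by `1` off `G`, where `Gᶜ` weighs at most `ξ`:
`∑_j w_j c_j ≤ M + ξ`. [cite: Hastad2001, §6.1 (use of Cor. 6.10: "except with probability …")] -/
theorem avg_le_of_good [Fintype J] [DecidableEq J] {w : J → ℝ} (hw : ∀ j, 0 ≤ w j)
    (hw1 : ∑ j, w j = 1) {G : Finset J} {ξ M : ℝ}
    (hG : ∑ j ∈ Gᶜ, w j ≤ ξ) (hM : 0 ≤ M) {c : J → ℝ} (hcG : ∀ j ∈ G, c j ≤ M) (hc1 : ∀ j, c j ≤ 1) :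
    ∑ j, w j * c j ≤ M + ξ := by
  rw [← sum_add_sum_compl G]
  refine add_le_add ?_ ?_
  · calc ∑ j ∈ G, w j * c j ≤ ∑ j ∈ G, w j * M :=
          sum_le_sum fun j hj => mul_le_mul_of_nonneg_left (hcG j hj) (hw j)
      _ = (∑ j ∈ G, w j) * M := by rw [sum_mul]
      _ ≤ 1 * M := mul_le_mul_of_nonneg_right (sum_weight_le_one hw hw1 G) hM
      _ = M := one_mul M
  · calc ∑ j ∈ Gᶜ, w j * c j ≤ ∑ j ∈ Gᶜ, w j * 1 :=
          sum_le_sum fun j _ => mul_le_mul_of_nonneg_left (hc1 j) (hw j)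
      _ ≤ ξ := by simpa using hG

/-! ### Lemma 6.7 (smooth form): the term `E[b(g₁) b(g₂)]` -/

/-- On a choice `j` injective on a subset `β' ⊆ β` of size `T`: `S^U_ε(β) ≥ Tε` (for `ε ≤ 1`), hence
`|p(α, β)| ≤ exp(-Tε/4)`. [cite: Hastad2001, §6.1 (eq. (40) with Cor. 6.10)] -/
theorem abs_termProd_le_exp_of_injOn [DecidableEq ι] {ε : ℝ} (hε : 0 ≤ ε) (hε' : ε ≤ 1 / 2) {π : κ → ι}
    {β' β : Finset κ} (hsub : β' ⊆ β) (hinj : Set.InjOn π ↑β') (α : Finset ι) :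
    |termProd ε π α β| ≤ Real.exp (-(β'.card * ε) / 4) := by
  refine (abs_termProd_le_exp hε hε' π α β).trans (Real.exp_le_exp.2 ?_)
  have h1 : SU ε β' π = β'.card * ε := by
    rw [SU_of_injOn ε hinj, min_eq_right (by linarith)]
  have h2 : SU ε β' π ≤ SU ε β π := SU_mono hε hsub π
  rw [h1] at h2
  linarith

/-- **The average of `p(∅, β)` over a smooth family** (nonempty `β`):
`|∑_j w_j p_j(∅, β)| ≤ ε + exp(-Tε/4) + ξ`. [cite: Hastad2001, Lemma 6.7 (proof)] -/
theorem abs_avg_termProd_empty_le [DecidableEq ι] [Fintype J] [DecidableEq J] {ε ξ : ℝ}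
    (hε : 0 ≤ ε) (hε' : ε ≤ 1 / 2) {T : ℕ}
    {w : J → ℝ} (hw : ∀ j, 0 ≤ w j) (hw1 : ∑ j, w j = 1) {π : J → κ → ι} (hsm : Smooth w π T ξ)
    {β : Finset κ} (hβ : β.Nonempty) :
    |∑ j, w j * termProd ε (π j) ∅ β| ≤ ε + Real.exp (-(T * ε) / 4) + ξ := by
  have hexp : 0 ≤ Real.exp (-(T * ε) / 4) := (Real.exp_pos _).le
  have habs : |∑ j, w j * termProd ε (π j) ∅ β| ≤ ∑ j, w j * |termProd ε (π j) ∅ β| :=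
    (abs_sum_le_sum_abs _ _).trans (le_of_eq (sum_congr rfl fun j _ => by
      rw [abs_mul, abs_of_nonneg (hw j)]))
  refine habs.trans ?_
  by_cases hT : β.card ≤ T
  · obtain ⟨G, hG, hGc⟩ := hsm β hT
    have h := avg_le_of_good hw hw1 hGc hε (c := fun j => |termProd ε (π j) ∅ β|)
      (fun j hj => ?_) (fun j => abs_termProd_le_one hε hε' _ _ _)
    · linarith
    · show |termProd ε (π j) ∅ β| ≤ ε
      rw [termProd_empty_of_injOn ε (hG j hj), abs_pow, abs_neg, abs_of_nonneg hε]
      calc ε ^ β.card ≤ ε ^ 1 := pow_le_pow_of_le_one hε (by linarith) hβ.card_pos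
        _ = ε := pow_one ε
  · push Not at hT
    obtain ⟨β', hβ', hcard⟩ := exists_subset_card_eq hT.le
    obtain ⟨G, hG, hGc⟩ := hsm β' hcard.le
    have h := avg_le_of_good hw hw1 hGc hexp (c := fun j => |termProd ε (π j) ∅ β|)
      (fun j hj => ?_) (fun j => abs_termProd_le_one hε hε' _ _ _)
    · linarith
    · show |termProd ε (π j) ∅ β| ≤ Real.exp (-(T * ε) / 4)
      have := abs_termProd_le_exp_of_injOn hε hε' hβ' (hG j hj) ∅
      rwa [hcard] at this

/-- **Håstad 2001, Lemma 6.7 (smooth form)**: `|E_j termOne_j| ≤ ε + exp(-Tε/4) + ξ`.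
[cite: Hastad2001, Lemma 6.7] -/
theorem abs_avg_termOne_le [DecidableEq ι] [Fintype κ] [DecidableEq κ] [Fintype J] [DecidableEq J]
    {ε ξ : ℝ} (hε : 0 ≤ ε) (hε' : ε ≤ 1 / 2) {T : ℕ}
    {w : J → ℝ} (hw : ∀ j, 0 ≤ w j) (hw1 : ∑ j, w j = 1) {π : J → κ → ι} (hsm : Smooth w π T ξ)
    {B : (κ → Bool) → Bool} (hB : IsFolded B) :
    |∑ j, w j * termOne ε (π j) B| ≤ ε + Real.exp (-(T * ε) / 4) + ξ := by
  set b : (κ → Bool) → ℝ := fun g => sgn (B g) with hb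
  set M := ε + Real.exp (-(T * ε) / 4) + ξ with hM
  -- exchange the sums
  have hex : ∑ j, w j * termOne ε (π j) B = ∑ β : Finset κ, coeff b β ^ 2 * ∑ j, w j * termProd ε (π j) ∅ β := by
    unfold termOne
    simp_rw [mul_sum]
    rw [sum_comm]
    refine sum_congr rfl fun β _ => sum_congr rfl fun j _ => ?_
    ring
  rw [hex]
  have hterm : ∀ β : Finset κ, |coeff b β ^ 2 * ∑ j, w j * termProd ε (π j) ∅ β| ≤ coeff b β ^ 2 * M := by
    intro β
    rw [abs_mul, abs_of_nonneg (sq_nonneg _)]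
    rcases β.eq_empty_or_nonempty with rfl | hβ
    · rw [coeff_empty_eq_zero_of_isOdd hB.isOdd_sgn]
      simp
    · exact mul_le_mul_of_nonneg_left (abs_avg_termProd_empty_le hε hε' hw hw1 hsm hβ) (sq_nonneg _)
  calc |∑ β : Finset κ, coeff b β ^ 2 * ∑ j, w j * termProd ε (π j) ∅ β|
      ≤ ∑ β : Finset κ, |coeff b β ^ 2 * ∑ j, w j * termProd ε (π j) ∅ β| := abs_sum_le_sum_abs _ _
    _ ≤ ∑ β : Finset κ, coeff b β ^ 2 * M := sum_le_sum fun β _ => hterm β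
    _ = M := by rw [← sum_mul, sum_coeff_sgn_sq, one_mul]

/-! ### Lemma 6.11 (smooth form): the term `E[a(f) b(g₁) b(g₂)]` -/

/-- The inner sum `∑_{α ⊆ π(β)} â(α) p(α, β)` of `termTwo`. [cite: Hastad2001, §6.1 (eq. (42))] -/
def innerTwo [Fintype ι] [DecidableEq ι] (ε : ℝ) (π : κ → ι) (A : (ι → Bool) → Bool) (β : Finset κ) : ℝ :=
  ∑ α ∈ (β.image π).powerset, coeff (fun f => sgn (A f)) α * termProd ε π α β

/-- **Eq. (44)**: `|∑_{α ⊆ π(β)} â(α) p(α, β)| ≤ exp(-S^U_ε(β)/8)` (Cauchy–Schwarz, `∑ â² ≤ 1`, and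
`∑_α p² ≤ exp(-S^U/4)`). [cite: Hastad2001, eq. (44)] -/
theorem abs_innerTwo_le_exp [Fintype ι] [DecidableEq ι] {ε : ℝ} (hε : 0 ≤ ε) (hε' : ε ≤ 1 / 2) (π : κ → ι)
    (A : (ι → Bool) → Bool) (β : Finset κ) :
    |innerTwo ε π A β| ≤ Real.exp (-(SU ε β π) / 8) := by
  set a : (ι → Bool) → ℝ := fun f => sgn (A f) with ha
  have hcs := sum_mul_sq_le_sq_mul_sq (β.image π).powerset (fun α => coeff a α)
    (fun α => termProd ε π α β)
  have h1 : ∑ α ∈ (β.image π).powerset, coeff a α ^ 2 ≤ 1 :=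
    sum_coeff_sq_le_one a (fun f => by rw [ha, sq, sgn_mul_self]) _
  have h2 := sum_termProd_sq_le_exp hε hε' π β
  have hsq : innerTwo ε π A β ^ 2 ≤ Real.exp (-(SU ε β π) / 8) ^ 2 := by
    rw [← Real.exp_nat_mul]
    have : ((2 : ℕ) : ℝ) * (-(SU ε β π) / 8) = -(SU ε β π) / 4 := by push_cast; ring
    rw [this]
    calc innerTwo ε π A β ^ 2 ≤ (∑ α ∈ (β.image π).powerset, coeff a α ^ 2) *
          ∑ α ∈ (β.image π).powerset, termProd ε π α β ^ 2 := hcs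
      _ ≤ 1 * Real.exp (-(SU ε β π) / 4) :=
          mul_le_mul h1 h2 (sum_nonneg fun _ _ => sq_nonneg _) zero_le_one
      _ = Real.exp (-(SU ε β π) / 4) := one_mul _
  exact (sq_le_sq.1 hsq).trans_eq (abs_of_pos (Real.exp_pos _))

/-- `|innerTwo| ≤ 1`. [cite: Hastad2001, eq. (44)] -/
theorem abs_innerTwo_le_one [Fintype ι] [DecidableEq ι] {ε : ℝ} (hε : 0 ≤ ε) (hε' : ε ≤ 1 / 2) (π : κ → ι)
    (A : (ι → Bool) → Bool) (β : Finset κ) : |innerTwo ε π A β| ≤ 1 :=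
  (abs_innerTwo_le_exp hε hε' π A β).trans (Real.exp_le_one_iff.2
    (div_nonpos_of_nonpos_of_nonneg (neg_nonpos.2 (SU_nonneg hε β π)) (by norm_num)))

/-- **The large sets** (`|β| > T`): `|E_j ∑_{|β| > T} b̂(β)² innerTwo_j(β)| ≤ exp(-Tε/8) + ξ`.
[cite: Hastad2001, Lemma 6.11 (proof, terms with |β| ≥ S)] -/
theorem abs_avg_large_le [Fintype ι] [DecidableEq ι] [Fintype κ] [DecidableEq κ] [Fintype J]
    [DecidableEq J] {ε ξ : ℝ} (hε : 0 ≤ ε) (hε' : ε ≤ 1 / 2) (hξ : 0 ≤ ξ) {T : ℕ}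
    {w : J → ℝ} (hw : ∀ j, 0 ≤ w j) (hw1 : ∑ j, w j = 1) {π : J → κ → ι} (hsm : Smooth w π T ξ)
    (A : J → (ι → Bool) → Bool) (B : (κ → Bool) → Bool) :
    |∑ j, w j * ∑ β ∈ univ.filter (fun β : Finset κ => T < β.card),
        coeff (fun g => sgn (B g)) β ^ 2 * innerTwo ε (π j) (A j) β| ≤
      Real.exp (-(T * ε) / 8) + ξ := by
  set b : (κ → Bool) → ℝ := fun g => sgn (B g) with hb
  set F := univ.filter (fun β : Finset κ => T < β.card) with hF
  set M := Real.exp (-(T * ε) / 8) + ξ with hM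
  have hexp : 0 ≤ Real.exp (-(T * ε) / 8) := (Real.exp_pos _).le
  -- pointwise bound on the average over `j` of `|innerTwo|` for a large `β`
  have hlarge : ∀ β ∈ F, ∑ j, w j * |innerTwo ε (π j) (A j) β| ≤ M := by
    intro β hβ
    rw [hF, mem_filter] at hβ
    obtain ⟨β', hβ', hcard⟩ := exists_subset_card_eq hβ.2.le
    obtain ⟨G, hG, hGc⟩ := hsm β' hcard.le
    refine avg_le_of_good hw hw1 hGc hexp (c := fun j => |innerTwo ε (π j) (A j) β|)
      (fun j hj => ?_) (fun j => abs_innerTwo_le_one hε hε' _ _ _)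
    refine (abs_innerTwo_le_exp hε hε' (π j) (A j) β).trans (Real.exp_le_exp.2 ?_)
    have h1 : SU ε β' (π j) = β'.card * ε := by
      rw [SU_of_injOn ε (hG j hj), min_eq_right (by linarith)]
    have h2 : SU ε β' (π j) ≤ SU ε β (π j) := SU_mono hε hβ' (π j)
    rw [h1, hcard] at h2
    linarith
  -- exchange sums and bound termwise
  calc |∑ j, w j * ∑ β ∈ F, coeff b β ^ 2 * innerTwo ε (π j) (A j) β|
      ≤ ∑ j, |w j * ∑ β ∈ F, coeff b β ^ 2 * innerTwo ε (π j) (A j) β| := abs_sum_le_sum_abs _ _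
    _ ≤ ∑ j, w j * ∑ β ∈ F, coeff b β ^ 2 * |innerTwo ε (π j) (A j) β| := by
        refine sum_le_sum fun j _ => ?_
        rw [abs_mul, abs_of_nonneg (hw j)]
        refine mul_le_mul_of_nonneg_left ((abs_sum_le_sum_abs _ _).trans (le_of_eq ?_)) (hw j)
        exact sum_congr rfl fun β _ => by rw [abs_mul, abs_of_nonneg (sq_nonneg _)]
    _ = ∑ β ∈ F, coeff b β ^ 2 * ∑ j, w j * |innerTwo ε (π j) (A j) β| := by
        simp_rw [mul_sum]
        rw [sum_comm]
        refine sum_congr rfl fun β _ => sum_congr rfl fun j _ => ?_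
        ring
    _ ≤ ∑ β ∈ F, coeff b β ^ 2 * M :=
        sum_le_sum fun β hβ => mul_le_mul_of_nonneg_left (hlarge β hβ) (sq_nonneg _)
    _ = (∑ β ∈ F, coeff b β ^ 2) * M := by rw [sum_mul]
    _ ≤ 1 * M := mul_le_mul_of_nonneg_right
        (sum_coeff_sq_le_one b (fun g => by rw [hb, sq, sgn_mul_self]) F) (by positivity)
    _ = M := one_mul M

/-- The per-choice decoding quantity `Q_j = ∑_β ∑_{α ⊆ π_j(β)} b̂(β)² â_j(α)² / |β|`.
[cite: Hastad2001, eq. (43)] -/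
def decodeQj [Fintype ι] [DecidableEq ι] [Fintype κ] [DecidableEq κ] (π : κ → ι)
    (A : (ι → Bool) → Bool) (B : (κ → Bool) → Bool) : ℝ :=
  ∑ β : Finset κ, ∑ α ∈ (β.image π).powerset,
    coeff (fun g => sgn (B g)) β ^ 2 * coeff (fun f => sgn (A f)) α ^ 2 / β.card

/-- `decodeQ` is the average of the `decodeQj`. [cite: Hastad2001, eq. (43)] -/
theorem decodeQ_eq_sum [Fintype ι] [DecidableEq ι] [Fintype κ] [DecidableEq κ] [Fintype J]
    (w : J → ℝ) (π : J → κ → ι) (A : J → (ι → Bool) → Bool) (B : (κ → Bool) → Bool) :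
    decodeQ w π A B = ∑ j, w j * decodeQj (π j) (A j) B := rfl

/-- **The small sets** (`|β| ≤ T`), one choice `j` (the two Cauchy–Schwarz steps of p. 48):
`(∑_{|β| ≤ T} b̂(β)² innerTwo_j(β))² ≤ T · Q_j`. [cite: Hastad2001, Lemma 6.11 (proof, terms with |β| < S)] -/
theorem sq_small_le [Fintype ι] [DecidableEq ι] [Fintype κ] [DecidableEq κ] {ε : ℝ} (hε : 0 ≤ ε)
    (hε' : ε ≤ 1 / 2) (T : ℕ) (π : κ → ι) (A : (ι → Bool) → Bool) {B : (κ → Bool) → Bool}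
    (hB : IsFolded B) :
    (∑ β ∈ univ.filter (fun β : Finset κ => β.card ≤ T),
        coeff (fun g => sgn (B g)) β ^ 2 * innerTwo ε π A β) ^ 2 ≤ T * decodeQj π A B := by
  set a : (ι → Bool) → ℝ := fun f => sgn (A f) with ha
  set b : (κ → Bool) → ℝ := fun g => sgn (B g) with hb
  set Fs := univ.filter (fun β : Finset κ => β.card ≤ T) with hFs
  set PAIRS := Fs.sigma (fun β : Finset κ => (β.image π).powerset) with hP
  -- the small sum as a sum over pairs `(β, α)`
  have hpairs : ∑ β ∈ Fs, coeff b β ^ 2 * innerTwo ε π A β =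
      ∑ p ∈ PAIRS, (coeff b p.1 * coeff a p.2) * (coeff b p.1 * termProd ε π p.2 p.1) := by
    rw [hP, sum_sigma]
    refine sum_congr rfl fun β _ => ?_
    unfold innerTwo
    rw [mul_sum]
    refine sum_congr rfl fun α _ => ?_
    ring
  rw [hpairs]
  refine (sum_mul_sq_le_sq_mul_sq PAIRS _ _).trans ?_
  -- the second factor is at most `1`
  have hY : ∑ p ∈ PAIRS, (coeff b p.1 * termProd ε π p.2 p.1) ^ 2 ≤ 1 := by
    rw [hP, sum_sigma]
    calc ∑ β ∈ Fs, ∑ α ∈ (β.image π).powerset, (coeff b β * termProd ε π α β) ^ 2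
        = ∑ β ∈ Fs, coeff b β ^ 2 * ∑ α ∈ (β.image π).powerset, termProd ε π α β ^ 2 := by
          refine sum_congr rfl fun β _ => ?_
          rw [mul_sum]
          exact sum_congr rfl fun α _ => by ring
      _ ≤ ∑ β ∈ Fs, coeff b β ^ 2 * 1 := by
          refine sum_le_sum fun β _ => mul_le_mul_of_nonneg_left ?_ (sq_nonneg _)
          exact (sum_termProd_sq_le_exp hε hε' π β).trans (Real.exp_le_one_iff.2
            (div_nonpos_of_nonpos_of_nonneg (neg_nonpos.2 (SU_nonneg hε β π)) (by norm_num)))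
      _ ≤ 1 := by
          simp_rw [mul_one]
          exact sum_coeff_sq_le_one b (fun g => by rw [hb, sq, sgn_mul_self]) Fs
  -- the first factor is at most `T · Q_j`
  have hX : ∑ p ∈ PAIRS, (coeff b p.1 * coeff a p.2) ^ 2 ≤ T * decodeQj π A B := by
    rw [hP, sum_sigma]
    unfold decodeQj
    rw [mul_sum, ← sum_filter_add_sum_filter_not univ (fun β : Finset κ => β.card ≤ T)]
    refine le_add_of_le_of_nonneg ?_ (sum_nonneg fun β _ => mul_nonneg (Nat.cast_nonneg _)
      (sum_nonneg fun α _ => by positivity))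
    refine sum_le_sum fun β hβ => ?_
    rw [hFs, mem_filter] at hβ
    rw [mul_sum]
    refine sum_le_sum fun α _ => ?_
    rcases β.eq_empty_or_nonempty with rfl | hne
    · rw [coeff_empty_eq_zero_of_isOdd hB.isOdd_sgn]
      simp
    · have hcard : (0 : ℝ) < β.card := by exact_mod_cast hne.card_pos
      have hle : (β.card : ℝ) ≤ T := by exact_mod_cast hβ.2
      rw [mul_pow, mul_div_assoc', le_div_iff₀ hcard]
      calc (coeff b β ^ 2 * coeff a α ^ 2) * β.card ≤ (coeff b β ^ 2 * coeff a α ^ 2) * T :=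
            mul_le_mul_of_nonneg_left hle (by positivity)
        _ = T * (coeff b β ^ 2 * coeff a α ^ 2) := by ring
  calc (∑ p ∈ PAIRS, (coeff b p.1 * coeff a p.2) ^ 2) * ∑ p ∈ PAIRS, (coeff b p.1 * termProd ε π p.2 p.1) ^ 2
      ≤ (T * decodeQj π A B) * 1 :=
        mul_le_mul hX hY (sum_nonneg fun _ _ => sq_nonneg _)
          (mul_nonneg (Nat.cast_nonneg _) ?_)
    _ = T * decodeQj π A B := mul_one _
  exact sum_nonneg fun β _ => sum_nonneg fun α _ => by positivity

/-- **The small sets, averaged**: `|E_j ∑_{|β| ≤ T} b̂(β)² innerTwo_j(β)| ≤ √(T · Q)` (Cauchy–Schwarz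
over `j`: `(E X)² ≤ E X²`). [cite: Hastad2001, Lemma 6.11 (proof)] -/
theorem abs_avg_small_le_sqrt [Fintype ι] [DecidableEq ι] [Fintype κ] [DecidableEq κ] [Fintype J]
    {ε : ℝ} (hε : 0 ≤ ε) (hε' : ε ≤ 1 / 2) (T : ℕ) {w : J → ℝ} (hw : ∀ j, 0 ≤ w j)
    (hw1 : ∑ j, w j = 1) (π : J → κ → ι) (A : J → (ι → Bool) → Bool) {B : (κ → Bool) → Bool}
    (hB : IsFolded B) :
    |∑ j, w j * ∑ β ∈ univ.filter (fun β : Finset κ => β.card ≤ T),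
        coeff (fun g => sgn (B g)) β ^ 2 * innerTwo ε (π j) (A j) β| ≤
      Real.sqrt (T * decodeQ w π A B) := by
  set S : J → ℝ := fun j => ∑ β ∈ univ.filter (fun β : Finset κ => β.card ≤ T),
    coeff (fun g => sgn (B g)) β ^ 2 * innerTwo ε (π j) (A j) β with hS
  refine Real.abs_le_sqrt ?_
  have hcs : (∑ j, w j * S j) ^ 2 ≤ (∑ j, w j) * ∑ j, w j * S j ^ 2 :=
    sum_sq_le_sum_mul_sum_of_sq_le_mul univ (fun j _ => hw j)
      (fun j _ => mul_nonneg (hw j) (sq_nonneg _)) (fun j _ => by ring_nf; rfl)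
  rw [hw1, one_mul] at hcs
  refine hcs.trans ?_
  rw [decodeQ_eq_sum, mul_sum]
  refine sum_le_sum fun j _ => ?_
  calc w j * S j ^ 2 ≤ w j * (T * decodeQj (π j) (A j) B) :=
        mul_le_mul_of_nonneg_left (sq_small_le hε hε' T (π j) (A j) hB) (hw j)
    _ = T * (w j * decodeQj (π j) (A j) B) := by ring

/-- `termTwo` in terms of `innerTwo`, split at `|β| = T`. [cite: Hastad2001, §6.1 (eq. (42))] -/
theorem termTwo_eq_small_add_large [Fintype ι] [DecidableEq ι] [Fintype κ] [DecidableEq κ]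
    (ε : ℝ) (T : ℕ) (π : κ → ι) (A : (ι → Bool) → Bool) (B : (κ → Bool) → Bool) :
    termTwo ε π A B =
      (∑ β ∈ univ.filter (fun β : Finset κ => β.card ≤ T),
          coeff (fun g => sgn (B g)) β ^ 2 * innerTwo ε π A β) +
        ∑ β ∈ univ.filter (fun β : Finset κ => T < β.card),
          coeff (fun g => sgn (B g)) β ^ 2 * innerTwo ε π A β := by
  unfold termTwo innerTwo
  rw [← sum_filter_add_sum_filter_not univ (fun β : Finset κ => β.card ≤ T)]
  congr 1
  refine sum_congr ?_ fun _ _ => rfl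
  ext β
  simp

/-- **Soundness of Test `3S^ε` at one `W`-vertex with smooth projections** (Håstad 2001, Lemmas 6.7,
6.11 and the quantitative core of Lemma 6.13, for a single `ε`): for folded tables, a probability
vector `w` on the choices and a `(T, ξ)`-smooth family of projections,
`8 (E_j[accProb_j] - 7/8) ≤ ε + e^{-Tε/4} + e^{-Tε/8} + 2ξ + √(T · Q)`.
[cite: Hastad2001, Lemma 6.13] -/
theorem smooth_vertex_soundness [Fintype ι] [DecidableEq ι] [Fintype κ] [DecidableEq κ] [Fintype J]
    [DecidableEq J] {ε ξ : ℝ} (hε : 0 ≤ ε) (hε' : ε ≤ 1 / 2) (hξ : 0 ≤ ξ) {T : ℕ} {w : J → ℝ}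
    (hw : ∀ j, 0 ≤ w j) (hw1 : ∑ j, w j = 1) {π : J → κ → ι} (hsm : Smooth w π T ξ)
    {A : J → (ι → Bool) → Bool} (hA : ∀ j, IsFolded (A j)) {B : (κ → Bool) → Bool}
    (hB : IsFolded B) :
    8 * (∑ j, w j * accProb ε (π j) (A j) B - 7 / 8) ≤
      ε + Real.exp (-(T * ε) / 4) + Real.exp (-(T * ε) / 8) + 2 * ξ +
        Real.sqrt (T * decodeQ w π A B) := by
  -- eq. (34) at every choice, averaged
  have hacc : ∑ j, w j * accProb ε (π j) (A j) B =
      7 / 8 - (∑ j, w j * termOne ε (π j) B + ∑ j, w j * termTwo ε (π j) (A j) B) / 8 := by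
    have e : ∀ j, w j * accProb ε (π j) (A j) B =
        (7 / 8 : ℝ) * w j - (w j * termOne ε (π j) B + w j * termTwo ε (π j) (A j) B) / 8 := by
      intro j; rw [accProb_eq ε (π j) (hA j) hB]; ring
    simp_rw [e]
    rw [sum_sub_distrib, ← mul_sum, hw1, mul_one, ← sum_div, sum_add_distrib]
  -- split termTwo
  have htwo : ∑ j, w j * termTwo ε (π j) (A j) B =
      (∑ j, w j * ∑ β ∈ univ.filter (fun β : Finset κ => β.card ≤ T),
          coeff (fun g => sgn (B g)) β ^ 2 * innerTwo ε (π j) (A j) β) +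
        ∑ j, w j * ∑ β ∈ univ.filter (fun β : Finset κ => T < β.card),
          coeff (fun g => sgn (B g)) β ^ 2 * innerTwo ε (π j) (A j) β := by
    rw [← sum_add_distrib]
    refine sum_congr rfl fun j _ => ?_
    rw [termTwo_eq_small_add_large ε T, mul_add]
  have h1 := abs_avg_termOne_le hε hε' hw hw1 hsm hB (T := T)
  have h2 := abs_avg_large_le hε hε' hξ hw hw1 hsm A B (T := T)
  have h3 := abs_avg_small_le_sqrt hε hε' T hw hw1 π A hB
  rw [hacc, htwo]
  have := neg_abs_le (∑ j, w j * termOne ε (π j) B)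
  have := neg_abs_le (∑ j, w j * ∑ β ∈ univ.filter (fun β : Finset κ => β.card ≤ T),
    coeff (fun g => sgn (B g)) β ^ 2 * innerTwo ε (π j) (A j) β)
  have := neg_abs_le (∑ j, w j * ∑ β ∈ univ.filter (fun β : Finset κ => T < β.card),
    coeff (fun g => sgn (B g)) β ^ 2 * innerTwo ε (π j) (A j) β)
  linarith

end Literature.Computability.Complexity.Hastad3Sat

end
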